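import Literature.Probability.RandomPlanarGeometry.ConformalTube
import Literature.Probability.RandomPlanarGeometry.JordanIndex
import Literature.Probability.RandomPlanarGeometry.PolygonalDomains
import Mathlib.Topology.Algebra.Order.Floor
import HarnessLib

/-!
# Collar domains of a general tube profile

Topic `Literature/Probability/RandomPlanarGeometry`; family `conformal-planar`. Given a Jordan
domain `D` with tube data `T` (`ConformalTube.lean`: `T.tube s t` is the two-sided collar
coordinate about `∂D`, `tube 1 t = ∂D(t)`, levels `s < 1` inside, `1 < s < 2` outside) and a
**profile** `p : ℝ → ℝ`, continuous, `1`-periodic, with values in `(0, 2)`, the **profile loop**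
`t ↦ tube (p t) t` is a Jordan curve: `∂D` pushed outwards where `p > 1` and inwards where `p < 1`.
This generalises `CollarDomain.lean` (whose profile is the specific bump profile
`MarkedDomain.profile` vanishing at the corners) to an ARBITRARY profile; the statements are about
an arbitrary Jordan domain `D'` whose frontier is the trace of the profile loop (for instance
`JordanDomain.ofLoop` of it), so no new definition is introduced.

Proved here: the profile loop is continuous, `1`-periodic and simple; the tube ray through `∂D(t)`
meets it only at the level `p t` (`tube_mem_range_profileLoop_iff`); if the loop is closer to `∂D`
than the depth of the centre `z₀` then `z₀ ∈ D'` (`z₀_mem_of_frontier_eq`, dog-on-leash for the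
index); tube points below the profile are in `D'`, tube points above it are not
(`tube_mem_of_frontier_eq`, `tube_not_mem_of_frontier_eq`); points of `D'` outside `closure D`
are tube points `tube s t` with `1 < s < p t`, points of `D'` in `D` are `Φ(u)` with `‖u‖ < 1` and,
off the centre, `= tube ‖u‖ t` with `‖u‖ < p t` (`exists_eq_tube_of_mem_of_not_mem_closure'`,
`exists_eq_tube_of_mem_of_mem'`). This is the geometry behind the domains `D'`, `D''` of
Bollobás–Riordan, *Percolation* (2006), Ch. 7 p. 186, Fig. 14, for profiles that need not vanish
at the corners.

## References

* B. Bollobás, O. Riordan, *Percolation*, Cambridge University Press (2006), Ch. 7 p. 186, Fig. 14.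

## Mathlib / tree

Mathlib: `Int.fract`, `Function.Periodic.sub_int_mul_eq`, `connectedComponentIn`. Tree: `ConformalTube` (`TubeData.tube` and its API),
`PolygonalDomains` (`JordanDomain.ofLoop`, `mem_ofLoop_carrier_iff`, `carrier_eq_of_frontier_eq`,
`ofLoop_carrier_self`), `JordanIndex` (`index`, `index_eq_zero_of_mem_exterior`,
`index_ne_zero_of_mem_carrier`), `WindingNumber` (`wind_eq_of_norm_sub_lt`).
-/

noncomputable section

open Set Metric Topology Filter Bornology

namespace Literature.Probability.RandomPlanarGeometry

namespace JordanDomain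

/-- **Inside = bounded complementary component**, for an arbitrary Jordan domain: a point lies in
the carrier iff it is off the frontier and its component in the complement of the frontier is
bounded. [folklore] -/
theorem mem_carrier_iff_isBounded (D : JordanDomain) {z : ℂ} :
    z ∈ D.carrier ↔ z ∉ frontier D.carrier ∧ IsBounded (connectedComponentIn (frontier D.carrier)ᶜ z) := by
  have h := mem_ofLoop_carrier_iff D.continuous_boundary D.periodic_boundary D.injOn_boundary (z := z)
  rw [ofLoop_carrier_self, D.range_boundary] at h
  exact h

namespace TubeData

variable {D : JordanDomain} (T : D.TubeData)

/-! ### Periodicity of the tube -/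

/-- A `1`-periodic function on `ℝ` is invariant under `Int.fract`. [folklore] -/
theorem _root_.Literature.Probability.RandomPlanarGeometry.apply_fract_of_periodic {β : Type*} {f : ℝ → β}
    (hf : Function.Periodic f 1) (t : ℝ) : f (Int.fract t) = f t := by
  have := hf.sub_int_mul_eq (x := t) ⌊t⌋
  rwa [mul_one] at this

/-- Each tube level `tube s` is `1`-periodic in the boundary parameter (general Jordan domain; cf.
`MarkedDomain.tube_add_one` for conformal rectangles). [folklore] -/
theorem periodic_tube (s : ℝ) : Function.Periodic (T.tube s) 1 := fun t => by
  simp only [TubeData.tube, T.Ci.periodic_β t, T.Ce.periodic_β t]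

/-- The tube at level `0` is the centre. [folklore] -/
theorem tube_zero (t : ℝ) : T.tube 0 t = T.z₀ := by
  rw [T.tube_of_le_one zero_le_one, Complex.ofReal_zero, zero_mul, T.Ci_zero]

/-! ### The profile loop -/

variable {p : ℝ → ℝ}

variable (hp : Continuous p) (hper : Function.Periodic p 1) (hp0 : ∀ u, 0 < p u) (hp2 : ∀ u, p u < 2)

include hp hp0 hp2 in
/-- **The profile loop `t ↦ tube (p t) t` is continuous.** [folklore] -/
theorem continuous_profileLoop : Continuous fun u => T.tube (p u) u :=
  T.continuous_tube_comp hp (fun u => by linarith [hp0 u]) hp2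

include hper in
/-- The profile loop is `1`-periodic. [folklore] -/
theorem periodic_profileLoop : Function.Periodic (fun u => T.tube (p u) u) 1 := fun u => by
  simp only [hper u]; exact T.periodic_tube (p u) u

include hp0 hp2 in
/-- The profile loop is injective on a period. [folklore] -/
theorem injOn_profileLoop : InjOn (fun u => T.tube (p u) u) (Ico 0 1) := by
  intro t ht t' ht' he
  have := T.injOn_tube (show ((p t, t) : ℝ × ℝ) ∈ {q : ℝ × ℝ | 0 < q.1 ∧ q.1 < 2 ∧ q.2 ∈ Ico (0 : ℝ) 1} from ⟨hp0 t, hp2 t, ht⟩)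
    (show ((p t', t') : ℝ × ℝ) ∈ {q : ℝ × ℝ | 0 < q.1 ∧ q.1 < 2 ∧ q.2 ∈ Ico (0 : ℝ) 1} from ⟨hp0 t', hp2 t', ht'⟩) he
  exact congrArg Prod.snd this

include hper hp0 hp2 in
/-- **A tube point `tube s t` (`0 ≤ s < 2`) lies on the profile loop iff `s = p t`.** [folklore] -/
theorem tube_mem_range_profileLoop_iff {s : ℝ} (hs0 : 0 ≤ s) (hs2 : s < 2) (t : ℝ) :
    T.tube s t ∈ range (fun u => T.tube (p u) u) ↔ s = p t := by
  constructor
  · rintro ⟨t', ht'⟩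
    simp only at ht'
    -- reduce both parameters to `[0, 1)`
    rw [← apply_fract_of_periodic (T.periodic_tube _) t', ← apply_fract_of_periodic hper t',
      ← apply_fract_of_periodic (T.periodic_tube s) t] at ht'
    have hp0' := hp0 (Int.fract t')
    have hp2' := hp2 (Int.fract t')
    rcases hs0.eq_or_lt with rfl | hs0'
    · -- `s = 0`: the centre `z₀` is not on the loop
      exfalso
      rw [T.tube_zero] at ht'
      rcases le_or_gt (p (Int.fract t')) 1 with hp1 | hp1
      · rw [T.tube_of_le_one hp1] at ht'
        have h0 := T.Ci.eq_zero_of_apply_eq (by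
          rw [norm_real_mul_of_norm_eq_one (T.Ci.norm_β _)]; exact abs_le.2 ⟨by linarith, hp1⟩)
          (ht'.trans T.Ci_zero.symm)
        rw [mul_eq_zero, Complex.ofReal_eq_zero] at h0
        rcases h0 with h0 | h0
        · linarith
        · have := T.Ci.norm_β (Int.fract t'); rw [h0, norm_zero] at this; exact zero_ne_one this
      · exact T.tube_not_mem_closure hp1 hp2' _ (ht'.symm ▸ subset_closure T.hz₀)
    · have := T.injOn_tube
        (show ((p (Int.fract t'), Int.fract t') : ℝ × ℝ) ∈ {q : ℝ × ℝ | 0 < q.1 ∧ q.1 < 2 ∧ q.2 ∈ Ico (0 : ℝ) 1}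
          from ⟨hp0', hp2', Int.fract_nonneg _, Int.fract_lt_one _⟩)
        (show ((s, Int.fract t) : ℝ × ℝ) ∈ {q : ℝ × ℝ | 0 < q.1 ∧ q.1 < 2 ∧ q.2 ∈ Ico (0 : ℝ) 1}
          from ⟨hs0', hs2, Int.fract_nonneg _, Int.fract_lt_one _⟩) ht'
      obtain ⟨hps, htt⟩ := Prod.ext_iff.1 this
      simp only at hps htt
      rw [← hps, htt, apply_fract_of_periodic hper]
  · rintro rfl
    exact ⟨t, rfl⟩

/-! ### A Jordan domain bounded by the profile loop -/

variable (D' : JordanDomain) (hD' : frontier D'.carrier = range fun u => T.tube (p u) u)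

include hD' in
/-- Membership in a Jordan domain bounded by the profile loop: off the loop, with bounded
complementary component. [folklore] -/
theorem mem_iff_of_frontier_eq {z : ℂ} : z ∈ D'.carrier ↔
    z ∉ range (fun u => T.tube (p u) u) ∧ IsBounded (connectedComponentIn (range fun u => T.tube (p u) u)ᶜ z) := by
  rw [D'.mem_carrier_iff_isBounded, hD']

include hp hper hp0 hp2 hD' in
/-- **The centre lies inside**, when the profile loop is closer to `∂D` than the depth of the
centre: the loop bounded by it has the index of `D` about `z₀` (dog-on-leash), which is nonzero.
[folklore] -/
theorem z₀_mem_of_frontier_eq (hclose : ∀ t, dist (T.tube (p t) t) (D.boundary t) < infDist T.z₀ (frontier D.carrier)) :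
    T.z₀ ∈ D'.carrier := by
  -- the Jordan domain bounded by the loop itself has the same carrier
  set C := ofLoop (T.continuous_profileLoop hp hp0 hp2) (T.periodic_profileLoop hper) (T.injOn_profileLoop hp0 hp2) with hC
  have hCD' : C.carrier = D'.carrier := carrier_eq_of_frontier_eq (by rw [frontier_ofLoop_carrier, hD'])
  rw [← hCD']
  -- the winding numbers of the two loops about `z₀` agree
  have hwind : C.index T.z₀ = D.index T.z₀ := by
    have hC1 : C.boundary 0 = C.boundary 1 := by have := C.periodic_boundary 0; rw [zero_add] at this; exact this.symm
    have hR1 : D.boundary 0 = D.boundary 1 := by have := D.periodic_boundary 0; rw [zero_add] at this; exact this.symm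
    refine Literature.Topology.PlaneTopology.wind_eq_of_norm_sub_lt
      ((C.continuous_boundary.sub continuous_const).continuousOn) (by rw [hC1])
      ⟨(D.continuous_boundary.sub continuous_const).continuousOn, fun t _ => ?_, by rw [hR1]⟩ fun t _ => ?_
    · exact sub_ne_zero.2 fun h0 => Set.disjoint_left.1 D.disjoint_carrier_frontier T.hz₀
        (by rw [← h0]; exact D.boundary_mem_frontier t)
    · rw [sub_sub_sub_cancel_right, ← dist_eq_norm, ← dist_eq_norm, dist_comm (D.boundary t) T.z₀]
      exact (hclose t).trans_le (infDist_le_dist_of_mem (D.boundary_mem_frontier t))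
  -- nonzero index forces `z₀` into the closure, and it is not on the loop
  have hne : C.index T.z₀ ≠ 0 := by rw [hwind]; exact D.index_ne_zero_of_mem_carrier T.hz₀
  have hcl : T.z₀ ∈ closure C.carrier := by
    by_contra hout
    exact hne (C.index_eq_zero_of_mem_exterior hout)
  rw [closure_eq_self_union_frontier] at hcl
  rcases hcl with h | h
  · exact h
  · exfalso
    rw [frontier_ofLoop_carrier, ← T.tube_zero 0, T.tube_mem_range_profileLoop_iff hper hp0 hp2 le_rfl two_pos] at h
    linarith [hp0 0]

include hper hp0 hp2 hD' in
/-- **Tube points below the profile are inside**: `tube s t ∈ D'` for `0 ≤ s < p t`, once the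
centre is inside. [folklore] -/
theorem tube_mem_of_frontier_eq (hz₀ : T.z₀ ∈ D'.carrier) {s t : ℝ} (hs0 : 0 ≤ s) (hs : s < p t) :
    T.tube s t ∈ D'.carrier := by
  -- the ray piece `{tube σ t : 0 ≤ σ ≤ s}` is connected, misses the loop and contains `z₀`
  set S := (fun σ => T.tube σ t) '' Icc 0 s with hS
  have hSc : IsConnected S := (isConnected_Icc hs0).image _
    ((T.continuousOn_tube_left t).mono fun σ hσ => ⟨by linarith [hσ.1], by linarith [hσ.2, hp2 t]⟩)
  have hSmiss : S ⊆ (range fun u => T.tube (p u) u)ᶜ := by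
    rintro _ ⟨σ, hσ, rfl⟩ hmem
    rw [T.tube_mem_range_profileLoop_iff hper hp0 hp2 hσ.1 (by linarith [hσ.2, hp2 t])] at hmem
    linarith [hσ.2]
  have hz₀S : T.z₀ ∈ S := ⟨0, left_mem_Icc.2 hs0, T.tube_zero t⟩
  have hzS : T.tube s t ∈ S := ⟨s, right_mem_Icc.2 hs0, rfl⟩
  rw [T.mem_iff_of_frontier_eq D' hD'] at hz₀ ⊢
  refine ⟨hSmiss hzS, ?_⟩
  rw [← connectedComponentIn_eq (hSc.isPreconnected.subset_connectedComponentIn hz₀S hSmiss hzS)]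
  exact hz₀.2

include hper hp0 hp2 hD' in
/-- **Tube points above the profile are outside**: `tube s t ∉ D'` for `p t < s < 2`. [folklore] -/
theorem tube_not_mem_of_frontier_eq {s t : ℝ} (hs : p t < s) (hs2 : s < 2) : T.tube s t ∉ D'.carrier := by
  -- the ray piece `{tube σ t : s ≤ σ < 2}` is connected, unbounded and misses the loop
  set S := (fun σ => T.tube σ t) '' Ico s 2 with hS
  have hSc : IsConnected S := (isConnected_Ico hs2).image _
    ((T.continuousOn_tube_left t).mono fun σ hσ => ⟨by linarith [hσ.1, hp0 t], hσ.2⟩)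
  have hSmiss : S ⊆ (range fun u => T.tube (p u) u)ᶜ := by
    rintro _ ⟨σ, hσ, rfl⟩ hmem
    rw [T.tube_mem_range_profileLoop_iff hper hp0 hp2 (by linarith [hσ.1, hp0 t]) hσ.2] at hmem
    linarith [hσ.1]
  have hSunb : ¬ IsBounded S := by
    obtain ⟨S', -, hS'unb, -, hS'sub⟩ := T.exists_outer_escape (s₀ := max s (3 / 2)) (by
      have : (3 : ℝ) / 2 ≤ max s (3 / 2) := le_max_right _ _; linarith) (max_lt hs2 (by norm_num)) t
    refine fun hb => hS'unb (hb.subset fun z hz => ?_)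
    obtain ⟨σ, h1, h2, rfl⟩ := hS'sub z hz
    exact ⟨σ, ⟨(le_max_left _ _).trans h1, h2⟩, rfl⟩
  intro hmem
  rw [T.mem_iff_of_frontier_eq D' hD'] at hmem
  have hzS : T.tube s t ∈ S := ⟨s, left_mem_Ico.2 hs2, rfl⟩
  exact hSunb (hmem.2.subset (hSc.isPreconnected.subset_connectedComponentIn hzS hSmiss))

include hper hp0 hp2 hD' in
/-- **Points of `D'` outside `closure D` are shallow exterior tube points**: such a point is
`tube s t` with `1 < s < p t`. [folklore] -/
theorem exists_eq_tube_of_mem_of_not_mem_closure' {z : ℂ} (hz : z ∈ D'.carrier) (hzΩ : z ∉ closure D.carrier) :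
    ∃ s t, 1 < s ∧ s < p t ∧ z = T.tube s t := by
  -- `ι z ∈ D*` is `Φ*(u)` with `u ≠ 0` in the open disc
  have hw : invMap T.z₀ z ∈ (D.inverted T.hz₀).carrier := D.invMap_mem_inverted T.hz₀ hzΩ
  obtain ⟨u, hu, hwu⟩ := T.Ce.bijOn_ball.surjOn hw
  have hu1 : ‖u‖ < 1 := mem_ball_zero_iff.1 hu
  have hu0 : u ≠ 0 := by
    rintro rfl
    rw [T.Ce_zero] at hwu
    exact (invMap_eq_zero_iff.1 hwu.symm ▸ hzΩ) (subset_closure T.hz₀)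
  have hn : 0 < ‖u‖ := norm_pos_iff.2 hu0
  set v : ℂ := ((‖u‖⁻¹ : ℝ) : ℂ) * u with hv
  have hv1 : ‖v‖ = 1 := by
    rw [hv, norm_mul, Complex.norm_real, Real.norm_eq_abs, abs_of_pos (inv_pos.2 hn), inv_mul_cancel₀ hn.ne']
  obtain ⟨t, ht⟩ : ∃ t, T.Ce.β t = v := by
    have hfr : T.Ce.Φ v ∈ frontier (D.inverted T.hz₀).carrier := T.Ce.apply_mem_frontier hv1
    rw [← (D.inverted T.hz₀).range_boundary] at hfr
    obtain ⟨t, ht⟩ := hfr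
    refine ⟨t, ?_⟩
    have h1 : T.Ce.Φ (T.Ce.β t) = T.Ce.Φ v := by rw [T.Ce.apply_β]; exact ht
    exact T.Ce.injOn (mem_closedBall_zero_iff.2 (T.Ce.norm_β t).le) (mem_closedBall_zero_iff.2 hv1.le) h1
  have hu' : u = ((‖u‖ : ℝ) : ℂ) * T.Ce.β t := by
    rw [ht, hv, ← mul_assoc, ← Complex.ofReal_mul, mul_inv_cancel₀ hn.ne', Complex.ofReal_one, one_mul]
  have hzt : z = T.tube (2 - ‖u‖) t := by
    rw [T.tube_of_one_lt (by linarith), show (2 - (2 - ‖u‖) : ℝ) = ‖u‖ by ring, ← hu', hwu, invMapInv_invMap]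
  refine ⟨2 - ‖u‖, t, by linarith, ?_, hzt⟩
  by_contra hle
  push Not at hle
  rcases hle.eq_or_lt with he | hlt
  · -- on the loop: not in the (open) carrier
    have hfr : z ∈ frontier D'.carrier := by
      rw [hD', hzt, T.tube_mem_range_profileLoop_iff hper hp0 hp2 (by linarith) (by linarith)]
      exact he.symm
    exact Set.disjoint_left.1 D'.disjoint_carrier_frontier hz hfr
  · exact T.tube_not_mem_of_frontier_eq hper hp0 hp2 D' hD' hlt (by linarith) (hzt ▸ hz)

include hper hp0 hp2 hD' in
/-- **Points of `D'` inside `D` are `Φ(u)` with `‖u‖ < 1`, and, off the centre, shallow or deep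
interior tube points `tube ‖u‖ t` with `‖u‖ < p t`.** [folklore] -/
theorem exists_eq_tube_of_mem_of_mem' {z : ℂ} (hz : z ∈ D'.carrier) (hzΩ : z ∈ D.carrier) :
    ∃ u t, ‖u‖ < 1 ∧ z = T.Ci.Φ u ∧ (u ≠ 0 → u = ((‖u‖ : ℝ) : ℂ) * T.Ci.β t ∧ z = T.tube ‖u‖ t ∧ ‖u‖ < p t) := by
  obtain ⟨u, hu, rfl⟩ := T.Ci.bijOn_ball.surjOn hzΩ
  have hu1 : ‖u‖ < 1 := mem_ball_zero_iff.1 hu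
  rcases eq_or_ne u 0 with rfl | hu0
  · exact ⟨0, 0, by simp, rfl, fun h => absurd rfl h⟩
  have hn : 0 < ‖u‖ := norm_pos_iff.2 hu0
  set v : ℂ := ((‖u‖⁻¹ : ℝ) : ℂ) * u with hv
  have hv1 : ‖v‖ = 1 := by
    rw [hv, norm_mul, Complex.norm_real, Real.norm_eq_abs, abs_of_pos (inv_pos.2 hn), inv_mul_cancel₀ hn.ne']
  obtain ⟨t, ht⟩ : ∃ t, T.Ci.β t = v := by
    have hfr : T.Ci.Φ v ∈ frontier D.carrier := T.Ci.apply_mem_frontier hv1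
    rw [← D.range_boundary] at hfr
    obtain ⟨t, ht⟩ := hfr
    refine ⟨t, ?_⟩
    have h1 : T.Ci.Φ (T.Ci.β t) = T.Ci.Φ v := by rw [T.Ci.apply_β]; exact ht
    exact T.Ci.injOn (mem_closedBall_zero_iff.2 (T.Ci.norm_β t).le) (mem_closedBall_zero_iff.2 hv1.le) h1
  have hu' : u = ((‖u‖ : ℝ) : ℂ) * T.Ci.β t := by
    rw [ht, hv, ← mul_assoc, ← Complex.ofReal_mul, mul_inv_cancel₀ hn.ne', Complex.ofReal_one, one_mul]
  have hzt : T.Ci.Φ u = T.tube ‖u‖ t := by rw [T.tube_of_le_one hu1.le, ← hu']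
  refine ⟨u, t, hu1, rfl, fun _ => ⟨hu', hzt, ?_⟩⟩
  by_contra hle
  push Not at hle
  rcases hle.eq_or_lt with he | hlt
  · have hfr : T.Ci.Φ u ∈ frontier D'.carrier := by
      rw [hD', hzt, T.tube_mem_range_profileLoop_iff hper hp0 hp2 hn.le (by linarith)]
      exact he.symm
    exact Set.disjoint_left.1 D'.disjoint_carrier_frontier hz hfr
  · exact T.tube_not_mem_of_frontier_eq hper hp0 hp2 D' hD' hlt (by linarith) (hzt ▸ hz)

include hper hp0 hp2 hD' in
/-- **Points of `D'` off `D` are exterior tube points on pushed-out rays**: such a point is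
`tube s t` with `1 ≤ s < p t` (so `p t > 1`). [folklore] -/
theorem exists_eq_tube_of_mem_of_not_mem' {z : ℂ} (hz : z ∈ D'.carrier) (hzΩ : z ∉ D.carrier) :
    ∃ s t, 1 ≤ s ∧ s < p t ∧ z = T.tube s t := by
  by_cases hcl : z ∈ closure D.carrier
  · -- on `∂D`: `z = ∂D(t) = tube 1 t`, and `1 < p t` since `z` is inside `D'`
    have hfr : z ∈ frontier D.carrier := by
      rw [frontier_eq_closure_inter_closure]; exact ⟨hcl, subset_closure hzΩ⟩
    rw [← D.range_boundary] at hfr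
    obtain ⟨t, rfl⟩ := hfr
    refine ⟨1, t, le_rfl, ?_, (T.tube_one t).symm⟩
    by_contra hle
    push Not at hle
    rcases hle.eq_or_lt with he | hlt
    · have : T.tube 1 t ∈ frontier D'.carrier := by
        rw [hD', T.tube_mem_range_profileLoop_iff hper hp0 hp2 zero_le_one one_lt_two]; exact he.symm
      rw [T.tube_one] at this
      exact Set.disjoint_left.1 D'.disjoint_carrier_frontier hz this
    · exact T.tube_not_mem_of_frontier_eq hper hp0 hp2 D' hD' hlt one_lt_two ((T.tube_one t).symm ▸ hz)
  · obtain ⟨s, t, hs1, hsp, rfl⟩ := T.exists_eq_tube_of_mem_of_not_mem_closure' hper hp0 hp2 D' hD' hz hcl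
    exact ⟨s, t, hs1.le, hsp, rfl⟩

include hper hp0 hp2 hD' in
/-- **Points of `D'` in `D` are interior tube points below the profile**: such a point is
`tube s t` with `0 ≤ s < 1` and `s < p t`. [folklore] -/
theorem exists_eq_tube_of_mem_of_mem'' {z : ℂ} (hz : z ∈ D'.carrier) (hzΩ : z ∈ D.carrier) :
    ∃ s t, 0 ≤ s ∧ s < 1 ∧ s < p t ∧ z = T.tube s t := by
  obtain ⟨u, t, hu1, hzu, hray⟩ := T.exists_eq_tube_of_mem_of_mem' hper hp0 hp2 D' hD' hz hzΩ
  rcases eq_or_ne u 0 with rfl | hu0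
  · exact ⟨0, t, le_rfl, one_pos, hp0 t, by rw [hzu, T.Ci_zero, T.tube_zero]⟩
  · obtain ⟨-, hzt, hup⟩ := hray hu0
    exact ⟨‖u‖, t, norm_nonneg _, hu1, hup, hzt⟩

end TubeData

end JordanDomain

end Literature.Probability.RandomPlanarGeometry
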